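/- Width seat `ym-line-sfw-p2-w5` (prover-ym-line-sfw-p2-w5-g18-0), free hands on planner ym-idea-2 g16's LINE-19 task board (STUB-PLAN-S4b §11,
the typed bookkeeping implication `EnergyDecayAssembly`; crux `AllWindowsColdBox.BoxHighWindowsSU22` = stmt-QuantumFields-24004 / 24335, stub S4b). -/
import Summits.QuantumFields.YangMills.Theorems.AllWindowsColdBoxBoxHighLineGradKernelEnergy

/-!
# LINE-19 S4b §11: `EnergyDecayAssembly` proved — Caccioppoli + S3b (kernel decay) + S3a (variance) ⇒ energy decay of the gradient-kernel row

The typed §11 interface `EnergyDecayAssembly := HodgeCaccioppoli → LandauKernelDecay → LandauVarianceBounded → GradKernelEnergyDecay`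
(✓`…BoxHighLineGradKernelEnergy`) is pure bookkeeping, proved here:

* near part (`j ≤ 1`): the whole ℓ²-row is `≤ (hodgeQ⁻¹)_{ee}` (`sum_sq_gradKernel_le_diag` ✓) `≤ C₃` (S3a);
* far part (`j ≥ 2`, `r = ⌊j/2⌋ ≥ 1`): Caccioppoli bounds `Σ_{d ≥ 2r} G² ≤ C₁ r⁻² Σ_{annulus r ≤ ℓ¹ < 2r+4} (hodgeQ⁻¹ e e')²`; on the annulus
  the sup-distance is `≥ ℓ¹/4 ≥ r/4` (`l1_le_four_mul_iSup`), so S3b gives `(hodgeQ⁻¹ e e')² ≤ 256·C₂²(1+log H)²/r⁴`, and the annulus has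
  `≤ 4·(4r+7)⁴ ≤ 4·(11r)⁴` edges (`card_free_filter_l1_le`: injection into a cube of `ℤ⁴` × the 4 directions, `ShellSum.card_cube`);
  `r⁻² ≤ 16/(1+j)²`.

Result: **`energyDecayAssembly : EnergyDecayAssembly`** (explicit constant `4·C₃⁺ + 16·(4·14641·256)·C₁⁺·(C₂⁺)²`, `C⁺ = max C 0`).  Everything proved; no
definition; standard axioms.  HONEST LABEL: a bookkeeping helper toward ONE registered stub (S4b) of a critic-PASSed line on the R2ξ″ RECORD-rung
crux 24004 / 24335; its three hypotheses (`HodgeCaccioppoli`, S3b, S3a) are OPEN; no stub is proved by name, no crux, rung or summit is proved;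
the Yang–Mills mass gap is NOT proved by this file.
-/

set_option autoImplicit false

noncomputable section

open Finset Matrix
open Literature.MathematicalPhysics.QuantumFieldTheory
open Literature.MathematicalPhysics.QuantumFieldTheory.LatticeMaxwell
open Literature.MathematicalPhysics.QuantumFieldTheory.AxialGauge
open Summit.QuantumFields.YangMills.Theorems.WeakCouplingRates
open Summit.QuantumFields.YangMills.Theorems.AllWindowsColdBox
open Summit.QuantumFields.YangMills.Theorems.AllWindowsColdBox.ShellSum
open Literature.Probability.LatticeModels (Site mem_halfOpenBox halfOpenBox)

namespace Summit.QuantumFields.YangMills.Theorems.AllWindowsColdBoxBoxHighLine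

/-- **Counting free edges**: the Landau free edges within ℓ¹ base-point distance `R` of `e` number at most `4·(2R+1)⁴`. -/
theorem card_free_filter_l1_le {H : ℕ} (e : LandauFree H) (R : ℕ) :
    #((Finset.univ : Finset (LandauFree H)).filter
        (fun e' => ∑ m : Fin 4, |e.1.1.1 m - e'.1.1.1 m| ≤ (R : ℤ))) ≤ 4 * (2 * R + 1) ^ 4 := by
  set S := (Finset.univ : Finset (LandauFree H)).filter (fun e' => ∑ m : Fin 4, |e.1.1.1 m - e'.1.1.1 m| ≤ (R : ℤ)) with hS
  set φ : LandauFree H → (Fin 4 → ℤ) × Fin 4 := fun e' => (fun m => e'.1.1.1 m - e.1.1.1 m, e'.1.1.2) with hφ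
  set T : Finset ((Fin 4 → ℤ) × Fin 4) :=
    (Fintype.piFinset (fun _ : Fin 4 => Finset.Icc (-(R : ℤ)) R)) ×ˢ (Finset.univ : Finset (Fin 4)) with hT
  have hinj : Set.InjOn φ (S : Set (LandauFree H)) := by
    intro p _ q _ h
    simp only [hφ, Prod.mk.injEq] at h
    obtain ⟨h1, h2⟩ := h
    have hb : p.1.1.1 = q.1.1.1 := by
      funext m
      have := congr_fun h1 m
      simpa using this
    exact Subtype.ext (Subtype.ext (Prod.ext hb h2))
  have hmaps : Set.MapsTo φ (S : Set (LandauFree H)) (T : Set ((Fin 4 → ℤ) × Fin 4)) := by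
    intro p hp
    have hd : ∑ m : Fin 4, |e.1.1.1 m - p.1.1.1 m| ≤ (R : ℤ) := (Finset.mem_filter.1 (Finset.mem_coe.1 hp)).2
    rw [Finset.mem_coe, hT, Finset.mem_product]
    refine ⟨?_, Finset.mem_univ _⟩
    rw [mem_cube]
    intro m
    have hle : |e.1.1.1 m - p.1.1.1 m| ≤ ∑ m' : Fin 4, |e.1.1.1 m' - p.1.1.1 m'| :=
      Finset.single_le_sum (f := fun m' => |e.1.1.1 m' - p.1.1.1 m'|) (fun _ _ => abs_nonneg _) (Finset.mem_univ m)
    simp only [hφ]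
    rw [abs_sub_comm]
    exact hle.trans hd
  calc #S ≤ #T := Finset.card_le_card_of_injOn φ hmaps hinj
    _ = 4 * (2 * R + 1) ^ 4 := by
        rw [hT, Finset.card_product, card_cube, Finset.card_univ, Fintype.card_fin]
        ring

/-- `ℓ¹ ≤ 4·ℓ∞` for the base-point difference (the sup-distance of S3b against the ℓ¹-distance of §11). -/
theorem l1_le_four_mul_iSup {H : ℕ} (e e' : LandauFree H) :
    (((∑ m : Fin 4, |e.1.1.1 m - e'.1.1.1 m| : ℤ)) : ℝ) ≤
      4 * ⨆ k : Fin 4, |((e.1.1.1 k - e'.1.1.1 k : ℤ) : ℝ)| := by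
  have hbdd : BddAbove (Set.range fun k : Fin 4 => |((e.1.1.1 k - e'.1.1.1 k : ℤ) : ℝ)|) := Set.finite_range _ |>.bddAbove
  have hk : ∀ k : Fin 4, |((e.1.1.1 k - e'.1.1.1 k : ℤ) : ℝ)| ≤ ⨆ k : Fin 4, |((e.1.1.1 k - e'.1.1.1 k : ℤ) : ℝ)| :=
    fun k => le_ciSup hbdd k
  rw [Int.cast_sum]
  calc ∑ m : Fin 4, (((|e.1.1.1 m - e'.1.1.1 m| : ℤ)) : ℝ)
      = ∑ m : Fin 4, |((e.1.1.1 m - e'.1.1.1 m : ℤ) : ℝ)| := Finset.sum_congr rfl fun m _ => Int.cast_abs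
    _ ≤ ∑ _m : Fin 4, ⨆ k : Fin 4, |((e.1.1.1 k - e'.1.1.1 k : ℤ) : ℝ)| := Finset.sum_le_sum fun m _ => hk m
    _ = 4 * ⨆ k : Fin 4, |((e.1.1.1 k - e'.1.1.1 k : ℤ) : ℝ)| := by simp

/-- Pointwise: on the annulus `ℓ¹ ≥ r` a kernel bound `|K| ≤ B/(1 + ℓ∞)²` gives `K² ≤ 256·B²/r⁴`. -/
theorem sq_le_of_kernelDecay_of_le_l1 {H : ℕ} (e e' : LandauFree H) {K B : ℝ} (hB : 0 ≤ B)
    (hK : |K| ≤ B / (1 + ⨆ k : Fin 4, |((e.1.1.1 k - e'.1.1.1 k : ℤ) : ℝ)|) ^ 2)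
    {r : ℕ} (hr1 : 1 ≤ r) (hlo : (r : ℤ) ≤ ∑ m : Fin 4, |e.1.1.1 m - e'.1.1.1 m|) :
    K ^ 2 ≤ 256 * B ^ 2 / (r : ℝ) ^ 4 := by
  have hr0 : (0 : ℝ) < r := by exact_mod_cast hr1
  have h4 := l1_le_four_mul_iSup e e'
  have hlo' : (r : ℝ) ≤ (((∑ m : Fin 4, |e.1.1.1 m - e'.1.1.1 m| : ℤ)) : ℝ) := by exact_mod_cast hlo
  have hs0 : 0 ≤ ⨆ k : Fin 4, |((e.1.1.1 k - e'.1.1.1 k : ℤ) : ℝ)| := by linarith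
  have hden : (r : ℝ) ^ 2 / 16 ≤ (1 + ⨆ k : Fin 4, |((e.1.1.1 k - e'.1.1.1 k : ℤ) : ℝ)|) ^ 2 := by nlinarith
  have hK' : |K| ≤ 16 * B / (r : ℝ) ^ 2 := by
    refine hK.trans ?_
    rw [div_le_div_iff₀ (by positivity) (by positivity)]
    nlinarith
  calc K ^ 2 = |K| ^ 2 := (sq_abs _).symm
    _ ≤ (16 * B / (r : ℝ) ^ 2) ^ 2 := pow_le_pow_left₀ (abs_nonneg _) hK' 2
    _ = 256 * B ^ 2 / (r : ℝ) ^ 4 := by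
        field_simp
        ring

/-- **The annulus energy**: with a kernel bound `|(hodgeQ⁻¹) e e'| ≤ B/(1+ℓ∞)²` for all `e'`, the ℓ²-mass of the row on the annulus
`r ≤ ℓ¹ < 2r+4` is `≤ 4·14641·256·B²` (uniformly in `r ≥ 1`). -/
theorem annulus_sum_sq_le {H : ℕ} (e : LandauFree H) {B : ℝ} (hB : 0 ≤ B)
    (hK : ∀ e' : LandauFree H, |(hodgeQ H)⁻¹ e e'| ≤ B / (1 + ⨆ k : Fin 4, |((e.1.1.1 k - e'.1.1.1 k : ℤ) : ℝ)|) ^ 2)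
    {r : ℕ} (hr1 : 1 ≤ r) :
    ∑ e' ∈ (Finset.univ : Finset (LandauFree H)).filter
        (fun e' => (r : ℤ) ≤ ∑ m : Fin 4, |e.1.1.1 m - e'.1.1.1 m| ∧ ∑ m : Fin 4, |e.1.1.1 m - e'.1.1.1 m| < 2 * r + 4),
        ((hodgeQ H)⁻¹ e e') ^ 2 ≤ 4 * 14641 * 256 * B ^ 2 := by
  have hr0 : (0 : ℝ) < r := by exact_mod_cast hr1
  have hpt : ∀ e' ∈ (Finset.univ : Finset (LandauFree H)).filter
      (fun e' => (r : ℤ) ≤ ∑ m : Fin 4, |e.1.1.1 m - e'.1.1.1 m| ∧ ∑ m : Fin 4, |e.1.1.1 m - e'.1.1.1 m| < 2 * r + 4),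
      ((hodgeQ H)⁻¹ e e') ^ 2 ≤ 256 * B ^ 2 / (r : ℝ) ^ 4 := fun e' he' =>
    sq_le_of_kernelDecay_of_le_l1 e e' hB (hK e') hr1 (Finset.mem_filter.1 he').2.1
  have hsub : (Finset.univ : Finset (LandauFree H)).filter
      (fun e' => (r : ℤ) ≤ ∑ m : Fin 4, |e.1.1.1 m - e'.1.1.1 m| ∧ ∑ m : Fin 4, |e.1.1.1 m - e'.1.1.1 m| < 2 * r + 4) ⊆
      (Finset.univ : Finset (LandauFree H)).filter
        (fun e' => ∑ m : Fin 4, |e.1.1.1 m - e'.1.1.1 m| ≤ ((2 * r + 3 : ℕ) : ℤ)) := by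
    intro e' he'
    rw [Finset.mem_filter] at he' ⊢
    refine ⟨he'.1, ?_⟩
    push_cast
    linarith [he'.2.2]
  have hcard : (#((Finset.univ : Finset (LandauFree H)).filter
      (fun e' => (r : ℤ) ≤ ∑ m : Fin 4, |e.1.1.1 m - e'.1.1.1 m| ∧ ∑ m : Fin 4, |e.1.1.1 m - e'.1.1.1 m| < 2 * r + 4)) : ℝ) ≤
      4 * (11 * (r : ℝ)) ^ 4 := by
    have h1 := (Finset.card_le_card hsub).trans (card_free_filter_l1_le e (2 * r + 3))
    have h2 : (#((Finset.univ : Finset (LandauFree H)).filter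
        (fun e' => (r : ℤ) ≤ ∑ m : Fin 4, |e.1.1.1 m - e'.1.1.1 m| ∧ ∑ m : Fin 4, |e.1.1.1 m - e'.1.1.1 m| < 2 * r + 4)) : ℝ) ≤
        4 * (2 * (2 * (r : ℝ) + 3) + 1) ^ 4 := by exact_mod_cast h1
    refine h2.trans ?_
    have hr1' : (1 : ℝ) ≤ r := by exact_mod_cast hr1
    have hb : 2 * (2 * (r : ℝ) + 3) + 1 ≤ 11 * r := by linarith
    exact mul_le_mul_of_nonneg_left (pow_le_pow_left₀ (by positivity) hb 4) (by norm_num)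
  refine (Finset.sum_le_sum hpt).trans ?_
  rw [Finset.sum_const, nsmul_eq_mul]
  refine (mul_le_mul_of_nonneg_right hcard (by positivity)).trans (le_of_eq ?_)
  field_simp
  ring

/-- **`EnergyDecayAssembly` proved.** -/
theorem energyDecayAssembly : EnergyDecayAssembly := by
  intro hCac hDec hVar
  obtain ⟨C₁, hC₁⟩ := hCac
  obtain ⟨C₂, hC₂⟩ := hDec
  obtain ⟨C₃, hC₃⟩ := hVar
  refine ⟨4 * max C₃ 0 + 16 * (4 * 14641 * 256) * max C₁ 0 * (max C₂ 0) ^ 2, fun H hH e j => ?_⟩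
  have hC₁'0 : 0 ≤ max C₁ 0 := le_max_right _ _
  have hC₂'0 : 0 ≤ max C₂ 0 := le_max_right _ _
  have hC₃'0 : 0 ≤ max C₃ 0 := le_max_right _ _
  have hH1 : (1 : ℝ) ≤ H := by exact_mod_cast hH
  have hL1 : 1 ≤ 1 + Real.log (H : ℝ) := by have := Real.log_nonneg hH1; linarith
  have hj0 : (0 : ℝ) < (1 + (j : ℝ)) ^ 2 := by positivity
  have hsum0 : 0 ≤ ∑ p ∈ (hodgePlaqs H).filter (fun p => (j : ℤ) ≤ edgePlaqDist e p),
      (((hodgeQ H)⁻¹ *ᵥ landauCoeff H p) e) ^ 2 := Finset.sum_nonneg fun _ _ => sq_nonneg _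
  -- the near part: the whole row is bounded by the variance (S3a)
  have hnear : ∑ p ∈ (hodgePlaqs H).filter (fun p => (j : ℤ) ≤ edgePlaqDist e p),
      (((hodgeQ H)⁻¹ *ᵥ landauCoeff H p) e) ^ 2 ≤ max C₃ 0 :=
    calc ∑ p ∈ (hodgePlaqs H).filter (fun p => (j : ℤ) ≤ edgePlaqDist e p), (((hodgeQ H)⁻¹ *ᵥ landauCoeff H p) e) ^ 2
        ≤ ∑ p ∈ hodgePlaqs H, (((hodgeQ H)⁻¹ *ᵥ landauCoeff H p) e) ^ 2 :=
          Finset.sum_le_sum_of_subset_of_nonneg (Finset.filter_subset _ _) fun _ _ _ => sq_nonneg _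
      _ ≤ (hodgeQ H)⁻¹ e e := sum_sq_gradKernel_le_diag H e
      _ ≤ max C₃ 0 := (hC₃ H hH e).trans (le_max_left _ _)
  rw [le_div_iff₀ hj0]
  by_cases hj : j ≤ 1
  · -- near: `(1+j)² ≤ 4`, `L² ≥ 1`
    have h4 : (1 + (j : ℝ)) ^ 2 ≤ 4 := by
      have : (j : ℝ) ≤ 1 := by exact_mod_cast hj
      nlinarith
    have hL2 : 1 ≤ (1 + Real.log (H : ℝ)) ^ 2 := one_le_pow₀ hL1
    have hfar0 : 0 ≤ 16 * (4 * 14641 * 256) * max C₁ 0 * (max C₂ 0) ^ 2 * (1 + Real.log (H : ℝ)) ^ 2 := by positivity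
    nlinarith
  · -- far: `r = ⌊j/2⌋ ≥ 1`; Caccioppoli + the annulus energy
    push Not at hj
    obtain ⟨r, hr⟩ : ∃ r : ℕ, r = j / 2 := ⟨_, rfl⟩
    have hr1 : 1 ≤ r := by omega
    have h2r : 2 * r ≤ j := by omega
    have hjr : j ≤ 2 * r + 1 := by omega
    have hr0 : (0 : ℝ) < r := by exact_mod_cast hr1
    have hK : ∀ e' : LandauFree H, |(hodgeQ H)⁻¹ e e'| ≤
        max C₂ 0 * (1 + Real.log (H : ℝ)) / (1 + ⨆ k : Fin 4, |((e.1.1.1 k - e'.1.1.1 k : ℤ) : ℝ)|) ^ 2 := fun e' =>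
      (hC₂ H hH e e').trans
        (div_le_div_of_nonneg_right (mul_le_mul_of_nonneg_right (le_max_left _ _) (by linarith)) (by positivity))
    have hAle := annulus_sum_sq_le e (B := max C₂ 0 * (1 + Real.log (H : ℝ))) (by positivity) hK hr1
    have hsub2 : (hodgePlaqs H).filter (fun p => (j : ℤ) ≤ edgePlaqDist e p) ⊆
        (hodgePlaqs H).filter (fun p => 2 * (r : ℤ) ≤ edgePlaqDist e p) := by
      intro p hp
      rw [Finset.mem_filter] at hp ⊢
      refine ⟨hp.1, ?_⟩
      have : (2 * r : ℤ) ≤ j := by exact_mod_cast h2r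
      linarith [hp.2]
    have hfar := (Finset.sum_le_sum_of_subset_of_nonneg hsub2 (f := fun p => (((hodgeQ H)⁻¹ *ᵥ landauCoeff H p) e) ^ 2)
      fun _ _ _ => sq_nonneg _).trans (hC₁ H hH e r hr1)
    have hrj : (1 + (j : ℝ)) ^ 2 ≤ 16 * (r : ℝ) ^ 2 := by
      have : (j : ℝ) ≤ 2 * r + 1 := by exact_mod_cast hjr
      have hr1' : (1 : ℝ) ≤ r := by exact_mod_cast hr1
      nlinarith
    -- abstract bookkeeping: X = the far sum, A = the annulus energy, L = 1 + log H
    have key : ∀ X A L : ℝ, 0 ≤ X → 0 ≤ A → 1 ≤ L → X ≤ C₁ / (r : ℝ) ^ 2 * A →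
        A ≤ 4 * 14641 * 256 * (max C₂ 0 * L) ^ 2 →
        X * (1 + (j : ℝ)) ^ 2 ≤ (4 * max C₃ 0 + 16 * (4 * 14641 * 256) * max C₁ 0 * (max C₂ 0) ^ 2) * L ^ 2 := by
      intro X A L hX0 hA0 hL1' hXA hAB
      have hXA' : X ≤ max C₁ 0 / (r : ℝ) ^ 2 * A :=
        hXA.trans (mul_le_mul_of_nonneg_right (div_le_div_of_nonneg_right (le_max_left C₁ 0) (by positivity)) hA0)
      have hnear0 : 0 ≤ 4 * max C₃ 0 * L ^ 2 := by positivity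
      calc X * (1 + (j : ℝ)) ^ 2 ≤ (max C₁ 0 / (r : ℝ) ^ 2 * A) * (16 * (r : ℝ) ^ 2) :=
            mul_le_mul hXA' hrj hj0.le (by positivity)
        _ = 16 * max C₁ 0 * A := by field_simp
        _ ≤ 16 * max C₁ 0 * (4 * 14641 * 256 * (max C₂ 0 * L) ^ 2) := mul_le_mul_of_nonneg_left hAB (by positivity)
        _ ≤ (4 * max C₃ 0 + 16 * (4 * 14641 * 256) * max C₁ 0 * (max C₂ 0) ^ 2) * L ^ 2 := by nlinarith
    exact key _ _ _ hsum0 (Finset.sum_nonneg fun _ _ => sq_nonneg _) hL1 hfar hAle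

end Summit.QuantumFields.YangMills.Theorems.AllWindowsColdBoxBoxHighLine

end
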